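import Summits.AtomisticToContinuum.HydrodynamicLimit.Theorems.CollisionIsometryCLTAprioriBoundsVisitLedgerDefs
import HarnessLib

/-!
# `AprioriBounds` (stmt-AtomisticToContinuum-9519), line `visit-ledger-upscattering`: the visit ledger

Registered stub `stub_ledger` (stub 5b of the lead's skeleton
`Cruxes/AprioriBounds/Lines/visit_ledger_upscattering.lean`; `--supports` the crux): the ADAPTER of
the line. For nice profiles, `0 < σ ≤ 1/2`, every flow family `Φ`, horizon `t > 0`, rate `λ > 0`
and envelope temperature `Θ > 0` with `2λΘ < 1`, cap constant `C` with `C² ≤ r`: the pathwise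
tiling bound (`TilingBound`, at every `N`) together with the four in-probability inputs B1
(`InitAt`), CAP (`CapAt`), (U♭) (`BulkAt`) and (R) (`RecollAt`) give component (i) of the crux at
rate `λ` (`TimeAvgAt`) with the deterministic constant
`Cexp = t C₀ + e^{λK₀} t + max C_R 0 · (max C_U 0 · t · S + t) + 1`,
`S = e^{λ} Σ_K (K+1) q^K`, `q = e^{λ - 1/(2Θ)} < 1`.

## Proof

Deterministic arithmetic on the good set off the four bad events, then a union bound.
* (1) the tiling bound and `¬`B1: `∫₀ᵗ ≤ t C₀ + e^{λK₀} t + (N+1)⁻¹ L_λ`;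
* (2) SHELL ARITHMETIC off the CAP and (U♭) events: every energetic entry `(τ, i)` has
  `E(τ,i) = |vᵢ(τ)|² ≤ C² log(N+2) ≤ r log(N+2)`, so its shell `K = ⌊E⌋` satisfies
  `K₀ ≤ K ≤ r log(N+2)` and holds at most `max C_U 0 · (N+1) ν_N t (K+1) e^{-K/2Θ}` entries; summing
  the finite entry set fibrewise over shells,
  `W_λ ≤ Σ_K e^{λ(K+1)} count_K ≤ max C_U 0 · (N+1) ν_N t · S` (partial sums of the convergent
  series `Σ (K+1) q^K` are bounded by its sum);
* (3) off the (R) event `ν_N L_λ ≤ max C_R 0 · (W_λ + (N+1) ν_N t)`, whence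
  `(N+1)⁻¹ L_λ ≤ max C_R 0 · (max C_U 0 · t S + t)` (`ν_N > 0`);
* (4) so the crux event at `Cexp` lies in `goodᶜ ∪ B1 ∪ CAP ∪ (U♭) ∪ (R)`; `goodᶜ` is null for the
  local Gibbs law (absolute continuity w.r.t. Liouville), the four events have probability `→ 0`
  by hypothesis, and subadditivity of the (outer) measure plus a squeeze conclude.
-/

noncomputable section

open MeasureTheory Filter Set Topology
open scoped ENNReal BigOperators

namespace Summit.AtomisticToContinuum.HydrodynamicLimit.Theorems.VisitLedgerUpscattering

open Literature.MathematicalPhysics.KineticTheory Literature.Analysis.FluidPDE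

/-! ## Finiteness of the entry sets on good orbits -/

/-- Own-collision times of sphere `i` are collision times of the orbit. -/
private theorem ownColl_subset_collisionTimes' (σ : ℝ) (N : ℕ) (Φ : Flow σ N) (z : Cfg N)
    (i : Fin (N + 1)) :
    ownColl σ N Φ z i ⊆
      collisionTimes (Torus.geometry (Fin 3)) (hsDiameter σ N) (fun s => Φ.flow s z) := by
  rintro τ ⟨j, hji, h | h⟩
  · exact ⟨i, j, fun hij => hji hij.symm, h⟩
  · exact ⟨j, i, hji, h⟩

/-- On a good orbit, the pairs `(τ, i)` with `τ` an own-collision time of `i` in `(0, t]` form a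
finite set (collision times are locally finite on hard-sphere trajectories). -/
private theorem finite_ownEntries {σ : ℝ} {N : ℕ} {Φ : Flow σ N} {z : Cfg N} (hz : z ∈ Φ.good)
    (t : ℝ) : {p : ℝ × Fin (N + 1) | p.1 ∈ ownColl σ N Φ z p.2 ∩ Ioc 0 t}.Finite := by
  refine (((Φ.isTrajectory z hz).locFinite 0 t).prod (finite_univ (α := Fin (N + 1)))).subset ?_
  rintro ⟨τ, i⟩ ⟨hτ, hτt⟩
  exact ⟨⟨ownColl_subset_collisionTimes' σ N Φ z i hτ, Ioc_subset_Icc_self hτt⟩, mem_univ _⟩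

/-- On a good orbit the set of energetic entries is finite. -/
private theorem entrySet_finite {σ : ℝ} {N : ℕ} {Φ : Flow σ N} {z : Cfg N} (hz : z ∈ Φ.good)
    (t : ℝ) (K₀ : ℕ) : (entrySet σ N Φ z t K₀).Finite :=
  (finite_ownEntries hz t).subset fun _ hp => hp.1

/-- On a good orbit every shell set is finite. -/
private theorem shellSet_finite {σ : ℝ} {N : ℕ} {Φ : Flow σ N} {z : Cfg N} (hz : z ∈ Φ.good)
    (t : ℝ) (K : ℕ) : (shellSet σ N Φ z t K).Finite :=
  (finite_ownEntries hz t).subset fun _ hp => hp.1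

/-- The entry weight is nonnegative. -/
private theorem entryWeight_nonneg (σ : ℝ) (N : ℕ) (Φ : Flow σ N) (z : Cfg N) (t : ℝ) (K₀ : ℕ)
    (lam : ℝ) : 0 ≤ entryWeight σ N Φ z t K₀ lam :=
  finsum_nonneg fun _ => finsum_nonneg fun _ => (Real.exp_pos _).le

/-! ## The shell series -/

/-- For `0 < Θ` and `2 λ Θ < 1` the ratio `q = e^{λ - 1/(2Θ)}` lies in `(0, 1)` and the shell
series `Σ_K (K+1) q^K` converges. -/
private theorem shellSeries_summable {lam Θ : ℝ} (hΘ : 0 < Θ) (hlamΘ : 2 * lam * Θ < 1) :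
    Real.exp (lam - 1 / (2 * Θ)) < 1 ∧
      Summable fun K : ℕ => ((K : ℝ) + 1) * Real.exp (lam - 1 / (2 * Θ)) ^ K := by
  set q : ℝ := Real.exp (lam - 1 / (2 * Θ)) with hq
  have hlt : lam < 1 / (2 * Θ) := by
    rw [lt_div_iff₀ (by positivity)]
    linarith [show lam * (2 * Θ) = 2 * lam * Θ by ring]
  have hq1 : q < 1 := Real.exp_lt_one_iff.2 (by linarith)
  have hq0 : 0 < q := Real.exp_pos _
  have hqn : ‖q‖ < 1 := by rwa [Real.norm_eq_abs, abs_of_pos hq0]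
  refine ⟨hq1, ?_⟩
  have h1 := summable_pow_mul_geometric_of_norm_lt_one 1 hqn
  have h2 := summable_geometric_of_lt_one hq0.le hq1
  exact (h1.add h2).congr fun K => by ring

/-! ## Shell arithmetic: the entry weight off the CAP and (U♭) events -/

/-- **Shell arithmetic.** On a good orbit on which no sphere is faster than `C √log(N+2)` on
`[0, t]` and every shell `K₀ ≤ K ≤ r log(N+2)` (`C² ≤ r`) holds at most
`C_U (N+1) ν_N t (K+1) e^{-K/2Θ}` entries, the entry weight is at most
`max C_U 0 · (N+1) ν_N t · e^{λ} Σ_K (K+1) q^K`. -/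
private theorem entryWeight_le {σ : ℝ} (hσ : 0 < σ) {N : ℕ} {Φ : Flow σ N} {z : Cfg N}
    (hz : z ∈ Φ.good) {t lam Θ r : ℝ} (ht : 0 < t) (hlam : 0 < lam) (hΘ : 0 < Θ)
    (hlamΘ : 2 * lam * Θ < 1) {K₀ : ℕ} {C CU : ℝ} (hCr : C ^ 2 ≤ r)
    (hcap : ∀ r' ∈ Icc 0 t, ∀ i, ‖(Φ.flow r' z i).2‖ ≤ C * Real.sqrt (Real.log ((N : ℝ) + 2)))
    (hbulk : ∀ K : ℕ, K₀ ≤ K → (K : ℝ) ≤ r * Real.log ((N : ℝ) + 2) →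
      (shellCount σ N Φ z t K : ℝ) ≤
        CU * (((N : ℝ) + 1) * nu σ N * t * ((K : ℝ) + 1) * Real.exp (-(K : ℝ) / (2 * Θ)))) :
    entryWeight σ N Φ z t K₀ lam ≤
      max CU 0 * (((N : ℝ) + 1) * nu σ N * t) *
        (Real.exp lam * ∑' K : ℕ, ((K : ℝ) + 1) * Real.exp (lam - 1 / (2 * Θ)) ^ K) := by
  classical
  obtain ⟨hq1, hsum⟩ := shellSeries_summable hΘ hlamΘ
  set q : ℝ := Real.exp (lam - 1 / (2 * Θ)) with hq
  have hq0 : 0 < q := Real.exp_pos _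
  have hν : 0 < nu σ N := nu_pos hσ N
  have hlog : 0 ≤ Real.log ((N : ℝ) + 2) :=
    Real.log_nonneg (by linarith [(N.cast_nonneg : (0 : ℝ) ≤ N)])
  -- the finite entry set and its shell index
  have hfin : (entrySet σ N Φ z t K₀).Finite := entrySet_finite hz t K₀
  set s : Finset (ℝ × Fin (N + 1)) := hfin.toFinset with hs
  set Kf : ℝ × Fin (N + 1) → ℕ := fun p => ⌊postE σ N Φ z p.1 p.2⌋₊ with hKf
  -- every entry has outgoing energy at most `r log (N + 2)` (the cap)
  have hpost : ∀ p ∈ entrySet σ N Φ z t K₀, postE σ N Φ z p.1 p.2 ≤ r * Real.log ((N : ℝ) + 2) := by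
    intro p hp
    have hv := hcap p.1 ⟨hp.1.2.1.le, hp.1.2.2⟩ p.2
    calc postE σ N Φ z p.1 p.2 = ‖(Φ.flow p.1 z p.2).2‖ ^ 2 := rfl
      _ ≤ (C * Real.sqrt (Real.log ((N : ℝ) + 2))) ^ 2 := pow_le_pow_left₀ (norm_nonneg _) hv 2
      _ = C ^ 2 * Real.log ((N : ℝ) + 2) := by rw [mul_pow, Real.sq_sqrt hlog]
      _ ≤ r * Real.log ((N : ℝ) + 2) := mul_le_mul_of_nonneg_right hCr hlog
  -- (a) the entry weight as a finite sum, bounded termwise by the top of its shell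
  have hW : entryWeight σ N Φ z t K₀ lam =
      ∑ p ∈ s, Real.exp (lam * postE σ N Φ z p.1 p.2) :=
    finsum_mem_eq_finite_toFinset_sum _ hfin
  have h1 : ∑ p ∈ s, Real.exp (lam * postE σ N Φ z p.1 p.2) ≤
      ∑ p ∈ s, Real.exp (lam * ((Kf p : ℝ) + 1)) :=
    Finset.sum_le_sum fun p _ => Real.exp_le_exp.2
      (mul_le_mul_of_nonneg_left (Nat.lt_floor_add_one _).le hlam.le)
  -- (b) fibrewise over the shells
  have h2 : ∑ p ∈ s, Real.exp (lam * ((Kf p : ℝ) + 1)) =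
      ∑ K ∈ s.image Kf, ((s.filter fun p => Kf p = K).card : ℝ) * Real.exp (lam * ((K : ℝ) + 1)) := by
    rw [Finset.sum_comp (fun K : ℕ => Real.exp (lam * ((K : ℝ) + 1))) Kf]
    simp only [nsmul_eq_mul]
  -- (c) each shell: at most `shellCount K ≤ max CU 0 · (N+1) ν t (K+1) e^{-K/2Θ}` entries
  have h3 : ∀ K ∈ s.image Kf,
      ((s.filter fun p => Kf p = K).card : ℝ) * Real.exp (lam * ((K : ℝ) + 1)) ≤
        max CU 0 * (((N : ℝ) + 1) * nu σ N * t) * (Real.exp lam * (((K : ℝ) + 1) * q ^ K)) := by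
    intro K hK
    obtain ⟨p, hp, hpK⟩ := Finset.mem_image.1 hK
    have hpE : p ∈ entrySet σ N Φ z t K₀ := hfin.mem_toFinset.1 hp
    have hK0 : K₀ ≤ K := by
      rw [← hpK]
      exact Nat.le_floor hpE.2
    have hKr : (K : ℝ) ≤ r * Real.log ((N : ℝ) + 2) := by
      rw [← hpK]
      exact (Nat.floor_le (postE_nonneg σ N Φ z p.1 p.2)).trans (hpost p hpE)
    have hsub : (↑(s.filter fun p => Kf p = K) : Set (ℝ × Fin (N + 1))) ⊆ shellSet σ N Φ z t K := by
      intro p' hp'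
      obtain ⟨hp's, hp'K⟩ := Finset.mem_filter.1 (Finset.mem_coe.1 hp')
      have hp'E : p' ∈ entrySet σ N Φ z t K₀ := hfin.mem_toFinset.1 hp's
      refine ⟨hp'E.1, ?_, ?_⟩
      · rw [← hp'K]
        exact Nat.floor_le (postE_nonneg σ N Φ z p'.1 p'.2)
      · rw [← hp'K]
        exact Nat.lt_floor_add_one _
    have hcard : (s.filter fun p => Kf p = K).card ≤ shellCount σ N Φ z t K := by
      rw [shellCount, ← Set.ncard_coe_finset]
      exact Set.ncard_le_ncard hsub (shellSet_finite hz t K)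
    have hcnt : ((s.filter fun p => Kf p = K).card : ℝ) ≤
        max CU 0 * (((N : ℝ) + 1) * nu σ N * t * ((K : ℝ) + 1) * Real.exp (-(K : ℝ) / (2 * Θ))) :=
      calc ((s.filter fun p => Kf p = K).card : ℝ) ≤ (shellCount σ N Φ z t K : ℝ) := by
            exact_mod_cast hcard
        _ ≤ CU * (((N : ℝ) + 1) * nu σ N * t * ((K : ℝ) + 1) * Real.exp (-(K : ℝ) / (2 * Θ))) :=
            hbulk K hK0 hKr
        _ ≤ max CU 0 * (((N : ℝ) + 1) * nu σ N * t * ((K : ℝ) + 1) *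
              Real.exp (-(K : ℝ) / (2 * Θ))) :=
            mul_le_mul_of_nonneg_right (le_max_left _ _) (by positivity)
    have hexp : Real.exp (-(K : ℝ) / (2 * Θ)) * Real.exp (lam * ((K : ℝ) + 1)) =
        Real.exp lam * q ^ K := by
      rw [hq, ← Real.exp_nat_mul, ← Real.exp_add, ← Real.exp_add]
      congr 1
      ring
    calc ((s.filter fun p => Kf p = K).card : ℝ) * Real.exp (lam * ((K : ℝ) + 1))
        ≤ max CU 0 * (((N : ℝ) + 1) * nu σ N * t * ((K : ℝ) + 1) *
            Real.exp (-(K : ℝ) / (2 * Θ))) * Real.exp (lam * ((K : ℝ) + 1)) :=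
          mul_le_mul_of_nonneg_right hcnt (Real.exp_pos _).le
      _ = max CU 0 * (((N : ℝ) + 1) * nu σ N * t) * (((K : ℝ) + 1) *
            (Real.exp (-(K : ℝ) / (2 * Θ)) * Real.exp (lam * ((K : ℝ) + 1)))) := by ring
      _ = max CU 0 * (((N : ℝ) + 1) * nu σ N * t) * (Real.exp lam * (((K : ℝ) + 1) * q ^ K)) := by
          rw [hexp]
          ring
  -- (d) sum over the shells and compare with the full series
  have h4 : ∑ K ∈ s.image Kf, ((K : ℝ) + 1) * q ^ K ≤ ∑' K : ℕ, ((K : ℝ) + 1) * q ^ K :=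
    hsum.sum_le_tsum _ fun K _ => by positivity
  calc entryWeight σ N Φ z t K₀ lam
      ≤ ∑ K ∈ s.image Kf, ((s.filter fun p => Kf p = K).card : ℝ) *
          Real.exp (lam * ((K : ℝ) + 1)) := by rw [hW, ← h2]; exact h1
    _ ≤ ∑ K ∈ s.image Kf,
          max CU 0 * (((N : ℝ) + 1) * nu σ N * t) * (Real.exp lam * (((K : ℝ) + 1) * q ^ K)) :=
        Finset.sum_le_sum h3
    _ = max CU 0 * (((N : ℝ) + 1) * nu σ N * t) *
          (Real.exp lam * ∑ K ∈ s.image Kf, ((K : ℝ) + 1) * q ^ K) := by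
        rw [Finset.mul_sum, Finset.mul_sum]
    _ ≤ max CU 0 * (((N : ℝ) + 1) * nu σ N * t) *
          (Real.exp lam * ∑' K : ℕ, ((K : ℝ) + 1) * q ^ K) :=
        mul_le_mul_of_nonneg_left (mul_le_mul_of_nonneg_left h4 (Real.exp_pos _).le)
          (by positivity)

/-! ## The deterministic bound on the good set off the four bad events -/

/-- **Steps (1)–(4) of the ledger.** On a good orbit off the four bad events (B1, CAP, (U♭), (R)),
the tiling bound gives `∫₀ᵗ (N+1)⁻¹Σᵢ e^{λ|vᵢ(s)|²} ds ≤ t C₀ + e^{λK₀} t +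
max C_R 0 · (max C_U 0 · t · S + t)` with `S = e^{λ} Σ_K (K+1) q^K`. -/
private theorem timeIntegral_le {σ : ℝ} (hσ : 0 < σ) {N : ℕ} {Φ : Flow σ N} {z : Cfg N}
    (hz : z ∈ Φ.good) {t lam Θ r : ℝ} {K₀ : ℕ} {C₀ C CU CR : ℝ} (ht : 0 < t) (hlam : 0 < lam)
    (hΘ : 0 < Θ) (hlamΘ : 2 * lam * Θ < 1) (hCr : C ^ 2 ≤ r)
    (htile : TilingBound σ N Φ t K₀ lam)
    (hinit : ∫ y, Real.exp (lam * ‖y.2‖ ^ 2) ∂(empiricalMeasure z) ≤ C₀)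
    (hcap : ∀ r' ∈ Icc 0 t, ∀ i, ‖(Φ.flow r' z i).2‖ ≤ C * Real.sqrt (Real.log ((N : ℝ) + 2)))
    (hbulk : ∀ K : ℕ, K₀ ≤ K → (K : ℝ) ≤ r * Real.log ((N : ℝ) + 2) →
      (shellCount σ N Φ z t K : ℝ) ≤
        CU * (((N : ℝ) + 1) * nu σ N * t * ((K : ℝ) + 1) * Real.exp (-(K : ℝ) / (2 * Θ))))
    (hrec : nu σ N * energeticLedger σ N Φ z t K₀ lam ≤
      CR * (entryWeight σ N Φ z t K₀ lam + ((N : ℝ) + 1) * nu σ N * t)) :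
    ∫ s in Icc 0 t, ∫ y, Real.exp (lam * ‖y.2‖ ^ 2) ∂(empiricalMeasure (Φ.flow s z)) ≤
      t * C₀ + Real.exp (lam * K₀) * t +
        max CR 0 * (max CU 0 * t *
          (Real.exp lam * ∑' K : ℕ, ((K : ℝ) + 1) * Real.exp (lam - 1 / (2 * Θ)) ^ K) + t) := by
  set S : ℝ := Real.exp lam * ∑' K : ℕ, ((K : ℝ) + 1) * Real.exp (lam - 1 / (2 * Θ)) ^ K with hS
  set W : ℝ := entryWeight σ N Φ z t K₀ lam with hWdef
  set L : ℝ := energeticLedger σ N Φ z t K₀ lam with hLdef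
  set X : ℝ := max CR 0 * (max CU 0 * t * S + t) with hX
  have hν : 0 < nu σ N := nu_pos hσ N
  have hn : (0 : ℝ) < (N : ℝ) + 1 := by positivity
  have hW0 : 0 ≤ W := entryWeight_nonneg σ N Φ z t K₀ lam
  have hW : W ≤ max CU 0 * (((N : ℝ) + 1) * nu σ N * t) * S :=
    entryWeight_le hσ hz ht hlam hΘ hlamΘ hCr hcap hbulk
  -- (3): off the (R) event, `ν L ≤ max CR 0 (W + (N+1) ν t) ≤ (N+1) ν X`
  have h1 : nu σ N * L ≤ max CR 0 * (W + ((N : ℝ) + 1) * nu σ N * t) :=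
    hrec.trans (mul_le_mul_of_nonneg_right (le_max_left _ _) (by positivity))
  have h2 : max CR 0 * (W + ((N : ℝ) + 1) * nu σ N * t) ≤ nu σ N * (((N : ℝ) + 1) * X) :=
    calc max CR 0 * (W + ((N : ℝ) + 1) * nu σ N * t)
        ≤ max CR 0 * (max CU 0 * (((N : ℝ) + 1) * nu σ N * t) * S + ((N : ℝ) + 1) * nu σ N * t) :=
          mul_le_mul_of_nonneg_left (by linarith) (le_max_right _ _)
      _ = nu σ N * (((N : ℝ) + 1) * X) := by
          rw [hX]
          ring
  have h3 : L ≤ ((N : ℝ) + 1) * X := le_of_mul_le_mul_left (h1.trans h2) hν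
  have h4 : ((N : ℝ) + 1)⁻¹ * L ≤ X := by
    rw [inv_mul_le_iff₀ hn]
    exact h3
  -- (1) + (4): the tiling bound and `¬`B1
  have hT := htile z hz
  rw [Nat.cast_succ] at hT
  calc ∫ s in Icc 0 t, ∫ y, Real.exp (lam * ‖y.2‖ ^ 2) ∂(empiricalMeasure (Φ.flow s z))
      ≤ t * ∫ y, Real.exp (lam * ‖y.2‖ ^ 2) ∂(empiricalMeasure z) + Real.exp (lam * K₀) * t +
          ((N : ℝ) + 1)⁻¹ * L := hT
    _ ≤ t * C₀ + Real.exp (lam * K₀) * t + X :=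
        add_le_add (add_le_add (mul_le_mul_of_nonneg_left hinit ht.le) le_rfl) h4

/-! ## The union bound -/

/-- **Union bound and squeeze.** If the events `A N` are covered by four events of probability
`→ 0` and a null set, then `P N (A N) → 0` (monotonicity and subadditivity of the outer measure;
no measurability is needed). -/
private theorem tendsto_of_cover {Ω : ℕ → Type*} [∀ N, MeasurableSpace (Ω N)]
    (P : ∀ N, Measure (Ω N)) {A G E₁ E₂ E₃ E₄ : ∀ N, Set (Ω N)}
    (hG : ∀ N, P N (G N)ᶜ = 0) (hcover : ∀ N, A N ⊆ E₁ N ∪ E₂ N ∪ E₃ N ∪ E₄ N ∪ (G N)ᶜ)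
    (h₁ : Tendsto (fun N => P N (E₁ N)) atTop (𝓝 0))
    (h₂ : Tendsto (fun N => P N (E₂ N)) atTop (𝓝 0))
    (h₃ : Tendsto (fun N => P N (E₃ N)) atTop (𝓝 0))
    (h₄ : Tendsto (fun N => P N (E₄ N)) atTop (𝓝 0)) :
    Tendsto (fun N => P N (A N)) atTop (𝓝 0) := by
  have hbound : ∀ N, P N (A N) ≤ P N (E₁ N) + P N (E₂ N) + P N (E₃ N) + P N (E₄ N) := fun N =>
    calc P N (A N) ≤ P N (E₁ N ∪ E₂ N ∪ E₃ N ∪ E₄ N ∪ (G N)ᶜ) := measure_mono (hcover N)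
      _ ≤ P N (E₁ N ∪ E₂ N ∪ E₃ N ∪ E₄ N) + P N (G N)ᶜ := measure_union_le _ _
      _ = P N (E₁ N ∪ E₂ N ∪ E₃ N ∪ E₄ N) := by rw [hG, add_zero]
      _ ≤ P N (E₁ N ∪ E₂ N ∪ E₃ N) + P N (E₄ N) := measure_union_le _ _
      _ ≤ P N (E₁ N ∪ E₂ N) + P N (E₃ N) + P N (E₄ N) :=
          add_le_add (measure_union_le _ _) le_rfl
      _ ≤ P N (E₁ N) + P N (E₂ N) + P N (E₃ N) + P N (E₄ N) :=
          add_le_add (add_le_add (measure_union_le _ _) le_rfl) le_rfl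
  have hlim : Tendsto (fun N => P N (E₁ N) + P N (E₂ N) + P N (E₃ N) + P N (E₄ N))
      atTop (𝓝 0) := by
    simpa using ((h₁.add h₂).add h₃).add h₄
  exact tendsto_of_tendsto_of_tendsto_of_le_of_le tendsto_const_nhds hlim (fun _ => zero_le)
    hbound

/-! ## The registered stub -/

/-- **STUB 5b — the visit ledger** (adapter of the line `visit-ledger-upscattering`). For nice
profiles, `0 < σ ≤ 1/2`, every flow family `Φ`, `t > 0`, rate `λ > 0` and envelope `Θ > 0` with
`2λΘ < 1`, cap constant `C` with `C² ≤ r`: the pathwise tiling bound at every `N` and the four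
events B1(`λ, C₀`), CAP(`t, C`), (U♭)(`t, r, Θ, K₀, C_U`), (R)(`t, λ, K₀, C_R`) imply component
(i) of the crux at rate `λ` with the deterministic constant
`Cexp = t C₀ + e^{λK₀} t + max C_R 0 · (max C_U 0 · t · e^{λ} Σ_K (K+1) e^{-K(1/2Θ-λ)} + t) + 1`:
on the good set off the four events the time integral is at most `Cexp - 1` (tiling bound, shell
arithmetic, the weighted re-collision statistic), and the union bound concludes. -/
theorem stub_ledger :
    ∀ (a₀ θ₀ : T3 → ℝ) (u₀ : T3 → V3), NiceProfiles a₀ θ₀ u₀ →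
      ∀ σ : ℝ, 0 < σ → σ ≤ 1 / 2 → ∀ Φ : Flows σ, ∀ t : ℝ, 0 < t →
        ∀ (lam Θ r : ℝ) (K₀ : ℕ) (C₀ C CU CR : ℝ),
          0 < lam → 0 < Θ → 2 * lam * Θ < 1 → C ^ 2 ≤ r →
          (∀ N : ℕ, TilingBound σ N (Φ N) t K₀ lam) →
          InitAt σ a₀ θ₀ u₀ Φ lam C₀ → CapAt σ a₀ θ₀ u₀ Φ t C →
          BulkAt σ a₀ θ₀ u₀ Φ t r Θ K₀ CU → RecollAt σ a₀ θ₀ u₀ Φ t lam K₀ CR →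
          ∃ Cexp : ℝ, TimeAvgAt σ a₀ θ₀ u₀ Φ t lam Cexp := by
  intro a₀ θ₀ u₀ _hP σ hσ _hσ2 Φ t ht lam Θ r K₀ C₀ C CU CR hlam hΘ hlamΘ hCr hTile hI hCap hU hR
  set S : ℝ := Real.exp lam * ∑' K : ℕ, ((K : ℝ) + 1) * Real.exp (lam - 1 / (2 * Θ)) ^ K with hS
  refine ⟨t * C₀ + Real.exp (lam * K₀) * t + max CR 0 * (max CU 0 * t * S + t) + 1, ?_⟩
  unfold TimeAvgAt
  unfold InitAt at hI
  unfold CapAt at hCap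
  unfold BulkAt at hU
  unfold RecollAt at hR
  refine tendsto_of_cover (fun N => localGibbsLaw σ a₀ u₀ θ₀ N (Φ N))
    (G := fun N => (Φ N).good) (fun N => ?_) (fun N z hzA => ?_) hI hCap hU hR
  · -- the good set is conull for the local Gibbs law
    show localGibbsLaw σ a₀ u₀ θ₀ N (Φ N) ((Φ N).good)ᶜ = 0
    rw [localGibbsLaw_eq]
    exact localGibbsMeasure_absolutelyContinuous σ a₀ u₀ θ₀ N (Φ N) (Φ N).measure_compl_good
  · -- the cover: on the good set off the four events the integral is at most `Cexp - 1`
    by_contra hnot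
    simp only [mem_union, mem_compl_iff, not_or, not_not, mem_setOf_eq] at hnot hzA
    obtain ⟨⟨⟨⟨h1, h2⟩, h3⟩, h4⟩, hz⟩ := hnot
    have hcap : ∀ r' ∈ Icc 0 t, ∀ i,
        ‖((Φ N).flow r' z i).2‖ ≤ C * Real.sqrt (Real.log ((N : ℝ) + 2)) := by
      intro r' hr' i
      by_contra h
      exact h2 ⟨r', hr', i, not_le.1 h⟩
    have hbulk : ∀ K : ℕ, K₀ ≤ K → (K : ℝ) ≤ r * Real.log ((N : ℝ) + 2) →
        (shellCount σ N (Φ N) z t K : ℝ) ≤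
          CU * (((N : ℝ) + 1) * nu σ N * t * ((K : ℝ) + 1) * Real.exp (-(K : ℝ) / (2 * Θ))) := by
      intro K hK hKr
      by_contra h
      exact h3 ⟨K, hK, hKr, not_le.1 h⟩
    have key := timeIntegral_le hσ hz ht hlam hΘ hlamΘ hCr (hTile N) (not_lt.1 h1) hcap hbulk
      (not_lt.1 h4)
    linarith

end Summit.AtomisticToContinuum.HydrodynamicLimit.Theorems.VisitLedgerUpscattering

end
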